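import Mathlib
import Summits.Ventures.HodgeRepro2.T5ProfiniteCharacterExtension
import Summits.Ventures.HodgeRepro2.T5CompactCharacterUnitary

/-!
# Continuous characters extend from any subgroup of a group with an open compact totally
# disconnected subgroup

Abstract form of the existence statement «a character `μ` of `E_v^×` with `μ|_{F_v^×} = η_v`»
(route/T5-route-2.md, the twist of Lemma N5.L4(ii) / §N5.12): the multiplicative group `E_v^×`
of a non-archimedean local field is not compact, but it contains the OPEN compact totally
disconnected subgroup `O_{E_v}^×`.  This file proves, for a commutative topological group `G` with
an open subgroup `K` that is compact and totally disconnected: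

* the open subgroups of `G` form a basis of neighbourhoods of `1` (`basis_of_isOpen_compact`,
  from `T5ProfiniteCharacterExtension.basis_of_profinite` applied to `K`);
* every continuous character `H →* Circle` of ANY subgroup `H ≤ G` extends to a continuous
  character of `G` (`exists_continuous_extension_circle`, from the `_of_basis` theorem of
  `T5ProfiniteCharacterExtension`);
* the `ℂˣ`-valued unitary form (`exists_continuous_extension_units`);
* the form «through a topological embedding `ι : A →* G`»: a continuous `η : A →* Circle` is
  `μ ∘ ι` for a continuous `μ : G →* Circle` (`exists_continuous_comp_eq_of_isEmbedding`) — the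
  shape in which `F_v^× ↪ E_v^×` enters.

Not modelled here: the local fields themselves (the instantiation on `Kˣ` for a complete
ultrametric normed field `K` with compact unit ball is `T5UnitsCharacterExtension`).

Declaration per README §8(d): «uses an L-value-free non-vanishing device: NO».
-/

namespace Summit.Ventures.HodgeRepro2.T5OpenCompactCharacterExtension

open Topology

variable {G : Type*} [CommGroup G] [TopologicalSpace G] [IsTopologicalGroup G]

omit [IsTopologicalGroup G] in
/-- A subgroup of an open subgroup `K ≤ G` that is open in `K` is open in `G`. -/
theorem isOpen_map_subtype (K : Subgroup G) (hK : IsOpen (K : Set G)) (U : Subgroup K)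
    (hU : IsOpen (U : Set K)) : IsOpen ((U.map K.subtype : Subgroup G) : Set G) := by
  rw [Subgroup.coe_map, Subgroup.coe_subtype]
  exact hK.isOpenMap_subtype_val _ hU

omit [IsTopologicalGroup G] in
/-- The basis property «the open subgroups form a basis of neighbourhoods of `1`» passes from an
open subgroup `K` to the whole group `G`. -/
theorem basis_of_isOpen_subgroup (K : Subgroup G) (hK : IsOpen (K : Set G))
    (hbasis : ∀ W : Set K, IsOpen W → (1 : K) ∈ W →
      ∃ U : Subgroup K, IsOpen (U : Set K) ∧ (U : Set K) ⊆ W) :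
    ∀ W : Set G, IsOpen W → (1 : G) ∈ W → ∃ U : Subgroup G, IsOpen (U : Set G) ∧ (U : Set G) ⊆ W := by
  intro W hW h1
  obtain ⟨U, hUo, hUW⟩ := hbasis (Subtype.val ⁻¹' W) (hW.preimage continuous_subtype_val) h1
  refine ⟨U.map K.subtype, isOpen_map_subtype K hK U hUo, ?_⟩
  rw [Subgroup.coe_map, Subgroup.coe_subtype]
  exact Set.image_subset_iff.mpr hUW

/-- If `G` has an open subgroup `K` that is compact and totally disconnected, the open subgroups
of `G` form a basis of neighbourhoods of `1`. -/
theorem basis_of_isOpen_compact (K : Subgroup G) (hK : IsOpen (K : Set G)) [CompactSpace K]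
    [TotallyDisconnectedSpace K] :
    ∀ W : Set G, IsOpen W → (1 : G) ∈ W → ∃ U : Subgroup G, IsOpen (U : Set G) ∧ (U : Set G) ⊆ W :=
  basis_of_isOpen_subgroup K hK (fun W hW h1 =>
    T5ProfiniteCharacterExtension.basis_of_profinite (G := K) W hW h1)

/-- Every continuous character of ANY subgroup `H` of a commutative topological group `G` with an
open compact totally disconnected subgroup `K` extends to a continuous character of `G`. -/
theorem exists_continuous_extension_circle (K : Subgroup G) (hK : IsOpen (K : Set G))
    [CompactSpace K] [TotallyDisconnectedSpace K] (H : Subgroup G) (χ : H →* Circle)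
    (hχ : Continuous χ) : ∃ χ' : G →* Circle, Continuous χ' ∧ ∀ h : H, χ' h = χ h :=
  T5ProfiniteCharacterExtension.exists_continuous_extension_circle_of_basis
    (basis_of_isOpen_compact K hK) H χ hχ

/-- The `ℂˣ`-valued form: a continuous unitary character of any subgroup `H ≤ G` extends to a
continuous unitary character of `G`. -/
theorem exists_continuous_extension_units (K : Subgroup G) (hK : IsOpen (K : Set G))
    [CompactSpace K] [TotallyDisconnectedSpace K] (H : Subgroup G) (φ : H →* ℂˣ)
    (hφ : Continuous φ) (hunit : ∀ h : H, ‖(φ h : ℂ)‖ = 1) :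
    ∃ φ' : G →* ℂˣ, Continuous φ' ∧ (∀ h : H, φ' h = φ h) ∧ ∀ g : G, ‖(φ' g : ℂ)‖ = 1 := by
  obtain ⟨χ', hχ', hext⟩ := exists_continuous_extension_circle K hK H
    (T5CompactCharacterUnitary.toCircle φ hunit)
    (T5CompactCharacterUnitary.continuous_toCircle φ hunit hφ)
  refine ⟨Circle.toUnits.comp χ', T5CompactCharacterUnitary.continuous_toUnits_comp χ' hχ',
    fun h => ?_, fun g => ?_⟩
  · apply Units.ext
    rw [MonoidHom.comp_apply, hext h, Circle.toUnits_apply, Units.val_mk0,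
      T5CompactCharacterUnitary.toCircle_coe]
  · rw [MonoidHom.comp_apply, Circle.toUnits_apply, Units.val_mk0, Circle.norm_coe]

section Embedding

variable {A : Type*} [CommGroup A] [TopologicalSpace A]

omit [IsTopologicalGroup G] in
/-- The inverse of the range-restriction of a topological embedding `ι : A →* G` is continuous. -/
theorem continuous_ofInjective_symm (ι : A →* G) (hι : IsEmbedding ι) :
    Continuous (MonoidHom.ofInjective hι.injective).symm := by
  rw [hι.continuous_iff]
  have : (ι ∘ (MonoidHom.ofInjective hι.injective).symm) = Subtype.val := by
    funext y
    simp only [Function.comp_apply]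
    rw [← MonoidHom.ofInjective_apply hι.injective, MulEquiv.apply_symm_apply]
  rw [this]
  exact continuous_subtype_val

/-- Through a topological embedding `ι : A →* G` (the inclusion `F_v^× ↪ E_v^×`): every
continuous character `η` of `A` is the pull-back `μ ∘ ι` of a continuous character `μ` of `G`,
when `G` has an open compact totally disconnected subgroup. -/
theorem exists_continuous_comp_eq_of_isEmbedding (K : Subgroup G) (hK : IsOpen (K : Set G))
    [CompactSpace K] [TotallyDisconnectedSpace K] (ι : A →* G) (hι : IsEmbedding ι)
    (η : A →* Circle) (hη : Continuous η) :
    ∃ μ : G →* Circle, Continuous μ ∧ ∀ a : A, μ (ι a) = η a := by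
  set e := MonoidHom.ofInjective hι.injective with he
  obtain ⟨μ, hμ, hext⟩ := exists_continuous_extension_circle K hK ι.range
    (η.comp e.symm.toMonoidHom) (hη.comp (continuous_ofInjective_symm ι hι))
  refine ⟨μ, hμ, fun a => ?_⟩
  have hmem : ι a ∈ ι.range := MonoidHom.mem_range.mpr ⟨a, rfl⟩
  have h1 : (⟨ι a, hmem⟩ : ι.range) = e a := by
    apply Subtype.ext
    rw [MonoidHom.ofInjective_apply]
  calc μ (ι a) = μ ((⟨ι a, hmem⟩ : ι.range) : G) := rfl
    _ = (η.comp e.symm.toMonoidHom) ⟨ι a, hmem⟩ := hext _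
    _ = η (e.symm (e a)) := by rw [h1]; rfl
    _ = η a := by rw [MulEquiv.symm_apply_apply]

/-- The `ℂˣ`-valued unitary form of `exists_continuous_comp_eq_of_isEmbedding`. -/
theorem exists_continuous_comp_eq_units_of_isEmbedding (K : Subgroup G) (hK : IsOpen (K : Set G))
    [CompactSpace K] [TotallyDisconnectedSpace K] (ι : A →* G) (hι : IsEmbedding ι)
    (η : A →* ℂˣ) (hη : Continuous η) (hunit : ∀ a : A, ‖(η a : ℂ)‖ = 1) :
    ∃ μ : G →* ℂˣ, Continuous μ ∧ (∀ a : A, μ (ι a) = η a) ∧ ∀ g : G, ‖(μ g : ℂ)‖ = 1 := by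
  obtain ⟨χ', hχ', hext⟩ := exists_continuous_comp_eq_of_isEmbedding K hK ι hι
    (T5CompactCharacterUnitary.toCircle η hunit)
    (T5CompactCharacterUnitary.continuous_toCircle η hunit hη)
  refine ⟨Circle.toUnits.comp χ', T5CompactCharacterUnitary.continuous_toUnits_comp χ' hχ',
    fun a => ?_, fun g => ?_⟩
  · apply Units.ext
    rw [MonoidHom.comp_apply, hext a, Circle.toUnits_apply, Units.val_mk0,
      T5CompactCharacterUnitary.toCircle_coe]
  · rw [MonoidHom.comp_apply, Circle.toUnits_apply, Units.val_mk0, Circle.norm_coe]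

end Embedding

end Summit.Ventures.HodgeRepro2.T5OpenCompactCharacterExtension
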